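import Literature.AlgebraicGeometry.ShimuraVarieties.UnitaryCurveConeHolomorphyOfCR
import Literature.NumberTheory.Automorphic.UnitaryCurveConeFrameCoordinates
import Literature.NumberTheory.Automorphic.UnitaryGroupLevelTransport
import HarnessLib

/-!
# Crux `HLiu418`, line LD2 — EVIDENCE for the cone-sign flip: a holomorphic cotangent slice for the frame `𝔣 = (v₀, t₀)` of `J` has a
# CONJUGATE slice that is a holomorphic cotangent slice for the flipped frame `𝔣♭ = (t₀, v₀)` of `−J`

Cell hodgecm-mathlib (D-0151), FLOOR 0; crux item `HLiu418` = stmt-HodgeConjecture-24832; half-A line LD2 (socket `stub_S1b_facts` of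
`Cruxes/HLiu418/Lines/F0_AlbCm.lean`, letter #74 `Rogawski1990.curveThetaHodgeTypeNecessity_hol`).  Seat LD2-p02 (g0).  THEOREMS ONLY (no `def`, no
instance, no notation, no named fact, no `sorry`); `--supports stmt-HodgeConjecture-24832 --as helper`.  HC_CM is proved only modulo the 7 printed citations
(2 remaining: hLiu418, h413) until rung 0 closes; this file discharges nothing printed.

## Why (the finding it supports)
The letters #74 ∕ G2 `F0P5CurveThetaLettersPaydown.PinnedHolNecessity₂` quantify over a frame `formCongr c g (t • H) = diagonal dV` with ONLY `t ≠ 0`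
(the crux's `S1BettiShape` also carries `0 < (ι₁ t).re`, `(ι₁ t).im = 0`), while their Hodge-type clause `P.IsHolCotangentAt₂ … 𝔣`,
`𝔣 : ConeFrame L H (cmPlace L ι)`, is read on the NEGATIVE CONE of `H^{e♮} = e♮(t)⁻¹ · (t • H)^{e♮}` (★ `UnitaryCurveCohCotangentForms`), whose sign
flips with `t`.  Under `(H, t) ↦ (−H, −t)` every other binder of the letters is unchanged (`t • H`, `dV`, `g`, the theta carrier, the datum
`U(−H) = U(H)`), and THIS FILE proves the archimedean heart of «`IsAntiholCotangentAt₂` for `(H, 𝔣)` ⇒ `IsHolCotangentAt₂` for `(−H, 𝔣♭)`»: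
clause (H) of ★ `holCotForms₂` («the `w₁`-slice is the restriction of an `IsConeHol` function») passes from a slice `Φ|_U` for `(J, 𝔣)` to the
CONJUGATE slice `conj ∘ Φ|_U` for `(−J, 𝔣♭)`, `𝔣♭ := (t₀, v₀)`; clauses (L), (Kc), (Sm) and `ContainsFun` of `holCotForms₂ ∕ IsHolCotangentAt₂` are
literally the same for `f` and `f̄`, and `U(−J^{e♮}) = U(J^{e♮})` (`archLocal_neg`).  Hence the letters, read at `(−H, −t)`, speak about the
ANTIHOLOMORPHIC `P` of `U(t • H)` with the HOLOMORPHIC sign — see the seat's memo `F0/P6/LD/LD2-p02/g0/MEMO-cone-flip-misstated-74.v1.LD2-p02g0.md`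
and the repair C′ (re-insert the crux's two positivity binders).

## What is proved (rank 2, `J ∈ M₂(E)`, `M := J^{e♮}` hermitian, `𝔣 : ConeFrame E J w₁`)
* §1 the flipped frame data: `t₀` is `(−M)`-negative, `v₀` is `(−M)`-positive, `⟪v₀, t₀⟫_{−M} = 0` — so `⟨t₀, v₀, …⟩ : ConeFrame E (−J) w₁`;
  `archLocal_neg : archLocal E 2 (−J) w₁ = archLocal E 2 J w₁`.
* §2 unitary elements stabilising the line `ℂ t₀`: `κ t₀ = k t₀`, `κ v₀ = a v₀ + d t₀` force `d = 0`, `k̄ k = 1`, `ā a = 1`; hence the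
  `𝔣`-cotangent law of `Φ` at `(k_𝔣, a_𝔣) := (a, k)` gives the `𝔣♭`-cotangent law for `conj ∘ Φ` at `(k, a)`:
  `conj Φ (u κ) = (a k⁻¹) · conj Φ (u)` (`conj (k a⁻¹) = a k⁻¹` on the unit circle).
* §3 the `𝔭`-probe of a frame in closed form: a skew `X` with `X z v₀ = z t₀` has `X z t₀ = (−(⟪t₀,t₀⟫∕⟪v₀,v₀⟫) z̄) v₀`.
* §4 **`exists_isConeHol_flip`** — for `Φ` with `IsConeHol 𝔣 Φ` there is `Φ♭` with `IsConeHol 𝔣♭ Φ♭` and `Φ♭ u = conj (Φ u)` for every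
  `u ∈ U(−M) = U(M)`: the rank-2 cone dictionary ★ `exists_isConeHol_extension_of_probeCR` (A-p14 (g16)) applied to `φ♭ := conj ∘ Φ|_U`, whose
  `𝔣♭`-probes are `conj ∘ (𝔣-probe of Φ) ∘ (z ↦ ρ z̄)` — real-differentiable with `ℂ`-linear differential by ★ `probeCR_of_isConeHol`.

## References
* [Borel1997] A. Borel, *Automorphic forms on SL₂(ℝ)*, §5.13–§5.14 (forms of weight `m` vs. `−m`: holomorphic on the upper vs. lower half plane).
* [BorelWallach2000] A. Borel, N. Wallach, 2nd ed., VII 2.10, 3.2 (complex conjugation exchanges the `(1,0)` and `(0,1)` cotangent forms).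
* [BergeronMillsonMoeglin2016Balls] N. Bergeron, J. Millson, C. Moeglin, Acta Math. 216 (2016), Part 2 §1.3 (negative lines; the cone).
* [Liu2021] Y. Liu, Camb. J. Math. 9 (2021), App. D Rem. D.5 (p. 131): the `(1,0)` and `(0,1)` cases carry OPPOSITE signs at `τ′₁`.
-/

set_option autoImplicit false
-- the mandated namespace has the single-problem summit's repeated segment (`HodgeConjecture.HodgeConjecture`)
set_option linter.dupNamespace false

noncomputable section

open Matrix NumberField NumberField.InfinitePlace
open scoped Matrix ComplexConjugate ComplexOrder
open Literature.NumberTheory.Automorphic Literature.NumberTheory.Automorphic.UnitaryGroup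
open Literature.NumberTheory.Automorphic.UnitaryCurveForms
open Literature.AlgebraicGeometry.ShimuraVarieties Literature.AlgebraicGeometry.ShimuraVarieties.UnitaryCurveCone

namespace Summit.HodgeConjecture.HodgeConjecture.Cruxes.HLiu418.F0LD2ConeFlip

variable {E : Type} [Field E] {J : Matrix (Fin 2) (Fin 2) E} {w₁ : {w : InfinitePlace E // IsComplex w}}

/-! ## §1 The flipped frame `𝔣♭ = (t₀, v₀)` of `−J`, and `U(−M) = U(M)` -/

/-- `(−J)^{e♮} = −J^{e♮}`. [folklore] -/
theorem map_neg_embedding : (-J).map w₁.1.embedding = -(J.map w₁.1.embedding) :=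
  Matrix.map_neg _ (map_neg _) _

/-- `t₀` is a NEGATIVE vector of `−M` (it is `M`-positive). [cite: BergeronMillsonMoeglin2016Balls, Part 2 §1.3] -/
theorem flip_v₀_mem (𝔣 : ConeFrame E J w₁) : 𝔣.t₀ ∈ negCone ((-J).map w₁.1.embedding) := by
  rw [mem_negCone_iff, map_neg_embedding, neg_mulVec, dotProduct_neg, Complex.neg_re, neg_lt_zero]
  exact 𝔣.t₀_pos

/-- `v₀` is a POSITIVE vector of `−M` (it is `M`-negative). [cite: BergeronMillsonMoeglin2016Balls, Part 2 §1.3] -/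
theorem flip_t₀_pos (𝔣 : ConeFrame E J w₁) : 0 < (star 𝔣.v₀ ⬝ᵥ ((-J).map w₁.1.embedding *ᵥ 𝔣.v₀)).re := by
  rw [map_neg_embedding, neg_mulVec, dotProduct_neg, Complex.neg_re, neg_pos]
  exact mem_negCone_iff.1 𝔣.v₀_mem

/-- `⟪v₀, t₀⟫_{−M} = 0` (hermitian symmetry of `⟪t₀, v₀⟫_M = 0`). [cite: Jacobson, Ch. V §7 pp. 150–151] -/
theorem flip_orth (hJ : (J.map w₁.1.embedding).IsHermitian) (𝔣 : ConeFrame E J w₁) :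
    star 𝔣.v₀ ⬝ᵥ ((-J).map w₁.1.embedding *ᵥ 𝔣.t₀) = 0 := by
  rw [map_neg_embedding, neg_mulVec, dotProduct_neg, form_v₀_t₀ 𝔣 hJ, neg_zero]

/-- `−M` is hermitian when `M` is. [folklore] -/
theorem isHermitian_neg (hJ : (J.map w₁.1.embedding).IsHermitian) : ((-J).map w₁.1.embedding).IsHermitian := by
  rw [map_neg_embedding]; exact hJ.neg

/-- **`U(−M) = U(M)`**: the unitary group at `w₁` only sees the similarity class of the form (★ `unitaryGroupOfForm_smul_of_isUnit` at `−1`).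
[cite: PlatonovRapinchuk1994, §2.3] -/
theorem archLocal_neg : archLocal E 2 (-J) w₁ = archLocal E 2 J w₁ := by
  show unitaryGroupOfForm _ _ = unitaryGroupOfForm _ _
  rw [map_neg_embedding, ← neg_one_smul ℂ (J.map w₁.1.embedding)]
  exact unitaryGroupOfForm_smul_of_isUnit _ (isUnit_one.neg) _

/-! ## §2 Unitary elements stabilising `ℂ t₀`, and the flipped cotangent law for `conj ∘ Φ` on `U` -/

/-- **A unitary `κ` with `κ t₀ = k t₀`, `κ v₀ = a v₀ + d t₀` has `d = 0`, `k̄ k = 1`, `ā a = 1`** (`κ` preserves `⟪·,·⟫_M`; `t₀^⊥ = ℂ v₀`).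
[cite: Jacobson, Ch. V §11 p. 162] -/
theorem frame_coords_of_unitary (hJ : (J.map w₁.1.embedding).IsHermitian) (𝔣 : ConeFrame E J w₁) (κ : archLocal E 2 J w₁) {k a d : ℂ}
    (hκt : ((κ : GL (Fin 2) ℂ) : Matrix (Fin 2) (Fin 2) ℂ) *ᵥ 𝔣.t₀ = k • 𝔣.t₀)
    (hκv : ((κ : GL (Fin 2) ℂ) : Matrix (Fin 2) (Fin 2) ℂ) *ᵥ 𝔣.v₀ = a • 𝔣.v₀ + d • 𝔣.t₀) :
    d = 0 ∧ starRingEnd ℂ k * k = 1 ∧ starRingEnd ℂ a * a = 1 := by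
  have hvt := form_v₀_t₀ 𝔣 hJ
  have hqt := form_t₀_ne_zero 𝔣
  have hqv := form_v₀_ne_zero 𝔣
  -- `⟪κ v₀, κ t₀⟫ = ⟪v₀, t₀⟫ = 0` gives `d̄ k ⟪t₀,t₀⟫ = 0`
  have h1 := form_mulVec_mulVec κ 𝔣.v₀ 𝔣.t₀
  rw [hκv, hκt, hvt, add_comm, show k • 𝔣.t₀ = k • 𝔣.t₀ + (0 : ℂ) • 𝔣.v₀ by rw [zero_smul, add_zero],
    form_frame_combination 𝔣 hvt, mul_zero, zero_mul, add_zero] at h1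
  have hk0 : k ≠ 0 := by
    intro hk
    have h2 := form_mulVec_mulVec κ 𝔣.t₀ 𝔣.t₀
    rw [hκt, hk, zero_smul, star_zero, zero_dotProduct] at h2
    exact hqt h2.symm
  have hd : d = 0 := by
    have : starRingEnd ℂ d = 0 := by
      rcases mul_eq_zero.1 h1 with h | h
      · rcases mul_eq_zero.1 h with h' | h'
        · exact h'
        · exact absurd h' hk0
      · exact absurd h hqt
    simpa using congrArg (starRingEnd ℂ) this
  -- `⟪κ t₀, κ t₀⟫ = ⟪t₀, t₀⟫` gives `k̄ k = 1`
  have h2 := form_mulVec_mulVec κ 𝔣.t₀ 𝔣.t₀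
  rw [hκt, show k • 𝔣.t₀ = k • 𝔣.t₀ + (0 : ℂ) • 𝔣.v₀ by rw [zero_smul, add_zero], form_frame_combination 𝔣 hvt, map_zero,
    zero_mul, zero_mul, add_zero] at h2
  have hk : starRingEnd ℂ k * k = 1 := mul_right_cancel₀ hqt (by rw [h2, one_mul])
  -- `⟪κ v₀, κ v₀⟫ = ⟪v₀, v₀⟫` gives `ā a = 1`
  have h3 := form_mulVec_mulVec κ 𝔣.v₀ 𝔣.v₀
  rw [hκv, hd, zero_smul, add_zero, show a • 𝔣.v₀ = (0 : ℂ) • 𝔣.t₀ + a • 𝔣.v₀ by rw [zero_smul, zero_add],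
    form_frame_combination 𝔣 hvt, map_zero, zero_mul, zero_mul, zero_add] at h3
  have ha : starRingEnd ℂ a * a = 1 := mul_right_cancel₀ hqv (by rw [h3, one_mul])
  exact ⟨hd, hk, ha⟩

/-- **The flipped cotangent law on the unitary group**: if `Φ` obeys the `𝔣`-law, then `φ♭ := conj ∘ Φ|_U` obeys the `𝔣♭`-law —
for unitary `u, κ` with `κ t₀ = k t₀`, `κ v₀ = a v₀ + d t₀` (`k ≠ 0`): `conj Φ (u κ) = (a k⁻¹) · conj Φ (u)` (the `𝔣`-law at `(a, k, 0)` gives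
`Φ (u κ) = (k a⁻¹) Φ u`, and `conj (k a⁻¹) = a k⁻¹` since `|k| = |a| = 1`).  Read on `U(−M) = U(M)`.
[cite: Borel1997, §5.13–§5.14] [cite: BorelWallach2000, VII 2.10] -/
theorem flip_law_of_unitary (hJ : (J.map w₁.1.embedding).IsHermitian) (𝔣 : ConeFrame E J w₁) {Φ : Matrix (Fin 2) (Fin 2) ℂ → ℂ}
    (hΦ : IsConeHol 𝔣 Φ) (u κ : archLocal E 2 (-J) w₁) (a k d : ℂ)
    (hκt : ((κ : GL (Fin 2) ℂ) : Matrix (Fin 2) (Fin 2) ℂ) *ᵥ 𝔣.t₀ = k • 𝔣.t₀)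
    (hκv : ((κ : GL (Fin 2) ℂ) : Matrix (Fin 2) (Fin 2) ℂ) *ᵥ 𝔣.v₀ = a • 𝔣.v₀ + d • 𝔣.t₀) :
    starRingEnd ℂ (Φ (((u * κ : archLocal E 2 (-J) w₁) : GL (Fin 2) ℂ) : Matrix (Fin 2) (Fin 2) ℂ)) =
      a * k⁻¹ * starRingEnd ℂ (Φ ((u : GL (Fin 2) ℂ) : Matrix (Fin 2) (Fin 2) ℂ)) := by
  -- move `u, κ` to `U(M)`
  let u' : archLocal E 2 J w₁ := ⟨u.1, archLocal_neg (J := J) ▸ u.2⟩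
  let κ' : archLocal E 2 J w₁ := ⟨κ.1, archLocal_neg (J := J) ▸ κ.2⟩
  obtain ⟨hd, hkk, haa⟩ := frame_coords_of_unitary hJ 𝔣 κ' hκt hκv
  have ha0 : a ≠ 0 := by
    intro h; rw [h, mul_zero] at haa; exact zero_ne_one haa
  obtain ⟨hu, huv⟩ := isUnit_and_mulVec_mem_negCone 𝔣 u'
  -- the `𝔣`-law at `(g, b) := (u, κ)` with line coefficient `a` and cotangent coefficient `k`
  have hlaw := hΦ.2 ((u : GL (Fin 2) ℂ) : Matrix (Fin 2) (Fin 2) ℂ) ((κ : GL (Fin 2) ℂ) : Matrix (Fin 2) (Fin 2) ℂ) k a 0 hu huv ha0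
    (by rw [hκv, hd, zero_smul, add_zero]) (by rw [hκt, zero_smul, add_zero])
  have hcoe : (((u * κ : archLocal E 2 (-J) w₁) : GL (Fin 2) ℂ) : Matrix (Fin 2) (Fin 2) ℂ) =
      ((u : GL (Fin 2) ℂ) : Matrix (Fin 2) (Fin 2) ℂ) * ((κ : GL (Fin 2) ℂ) : Matrix (Fin 2) (Fin 2) ℂ) := by
    rw [Subgroup.coe_mul, Units.val_mul]
  rw [hcoe, hlaw, map_mul, map_mul, map_inv₀]
  -- `conj k = k⁻¹`, `conj a = a⁻¹` on the unit circle
  have hk' : starRingEnd ℂ k = k⁻¹ := eq_inv_of_mul_eq_one_left hkk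
  have ha' : starRingEnd ℂ a = a⁻¹ := eq_inv_of_mul_eq_one_left haa
  rw [hk', ha', inv_inv]
  ring

/-! ## §3 The `𝔭`-probe in closed form -/

/-- **The antilinear half of a skew probe, in closed form**: if `X` is `M`-skew (`Xᴴ M + M X = 0`) with `X z v₀ = z t₀` and `X z t₀ ∈ ℂ v₀`,
then `X z t₀ = (−(⟪t₀,t₀⟫ ∕ ⟪v₀,v₀⟫) · z̄) v₀` (pair `X z t₀ = c v₀` with `v₀`: `c̄ ⟪v₀,v₀⟫ = ⟪X z t₀, v₀⟫ = −⟪t₀, X z v₀⟫ = −z ⟪t₀,t₀⟫`).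
[cite: BergeronMillsonMoeglin2016Balls, Part 2 §1.3] -/
theorem probe_mulVec_t₀ (hJ : (J.map w₁.1.embedding).IsHermitian) (𝔣 : ConeFrame E J w₁) (X : ℂ →ₗ[ℝ] Matrix (Fin 2) (Fin 2) ℂ)
    (hXu : ∀ z, (X z)ᴴ * J.map w₁.1.embedding + J.map w₁.1.embedding * X z = 0)
    (hXv : ∀ z, X z *ᵥ 𝔣.v₀ = z • 𝔣.t₀) (hXt : ∀ z, ∃ c : ℂ, X z *ᵥ 𝔣.t₀ = c • 𝔣.v₀) (z : ℂ) :
    X z *ᵥ 𝔣.t₀ = (-((star 𝔣.t₀ ⬝ᵥ (J.map w₁.1.embedding *ᵥ 𝔣.t₀)) / (star 𝔣.v₀ ⬝ᵥ (J.map w₁.1.embedding *ᵥ 𝔣.v₀))) *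
      starRingEnd ℂ z) • 𝔣.v₀ := by
  set M := J.map w₁.1.embedding with hM
  obtain ⟨c, hc⟩ := hXt z
  have hqv := form_v₀_ne_zero 𝔣
  -- `⟪X z t₀, v₀⟫ = c̄ ⟪v₀, v₀⟫`
  have h1 : star (X z *ᵥ 𝔣.t₀) ⬝ᵥ (M *ᵥ 𝔣.v₀) = starRingEnd ℂ c * (star 𝔣.v₀ ⬝ᵥ (M *ᵥ 𝔣.v₀)) := by
    rw [hc, star_smul, smul_dotProduct, smul_eq_mul, Complex.star_def]
  -- `⟪X z t₀, v₀⟫ = −⟪t₀, X z v₀⟫ = −z ⟪t₀, t₀⟫` (skewness)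
  have hskew : (X z)ᴴ * M = -(M * X z) := eq_neg_of_add_eq_zero_left (hXu z)
  have h2 : star (X z *ᵥ 𝔣.t₀) ⬝ᵥ (M *ᵥ 𝔣.v₀) = -(z * (star 𝔣.t₀ ⬝ᵥ (M *ᵥ 𝔣.t₀))) := by
    rw [star_mulVec, ← dotProduct_mulVec, mulVec_mulVec, hskew, neg_mulVec, dotProduct_neg, ← mulVec_mulVec, hXv, mulVec_smul,
      dotProduct_smul, smul_eq_mul]
  have hcc : starRingEnd ℂ c = -(z * (star 𝔣.t₀ ⬝ᵥ (M *ᵥ 𝔣.t₀))) / (star 𝔣.v₀ ⬝ᵥ (M *ᵥ 𝔣.v₀)) := by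
    rw [eq_div_iff hqv, ← h1, h2]
  have hqvr : starRingEnd ℂ (star 𝔣.v₀ ⬝ᵥ (M *ᵥ 𝔣.v₀)) = star 𝔣.v₀ ⬝ᵥ (M *ᵥ 𝔣.v₀) := star_dotProduct_mulVec_self hJ _
  have hqtr : starRingEnd ℂ (star 𝔣.t₀ ⬝ᵥ (M *ᵥ 𝔣.t₀)) = star 𝔣.t₀ ⬝ᵥ (M *ᵥ 𝔣.t₀) := star_dotProduct_mulVec_self hJ _
  have hc' : c = -((star 𝔣.t₀ ⬝ᵥ (M *ᵥ 𝔣.t₀)) / (star 𝔣.v₀ ⬝ᵥ (M *ᵥ 𝔣.v₀))) * starRingEnd ℂ z := by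
    have := congrArg (starRingEnd ℂ) hcc
    rw [Complex.conj_conj, map_div₀, map_neg, map_mul, hqvr, hqtr] at this
    rw [this]; ring
  rw [hc, hc']

/-! ## §4 The flip: an `IsConeHol 𝔣` function has a conjugate that is (the restriction of) an `IsConeHol 𝔣♭` function -/

/-- **THE CONE-SIGN FLIP.**  Let `M = J^{e♮}` be hermitian, `𝔣 = (v₀, t₀)` a cone frame of `J` and `Φ` an `IsConeHol 𝔣` function (holomorphic
on the cone of `M`-negative lines with the cotangent law of the frame).  Then for the FLIPPED frame `𝔣♭ = (t₀, v₀)` of `−J` (negative cone of `−M`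
= positive cone of `M`) there is an `IsConeHol 𝔣♭` function `Φ♭` with `Φ♭ u = conj (Φ u)` for every `u ∈ U(−M) = U(M)`.  Consequently the CONJUGATE
of a holomorphic-cotangent slice for `(J, 𝔣)` is a holomorphic-cotangent slice for `(−J, 𝔣♭)`: clause (H) of ★ `holCotForms₂` does not separate
«`(1,0)` for `J`» from «`(0,1)` for `J`» once `J ↦ −J` is allowed — the Hodge type of ★ `IsHolCotangentAt₂` is pinned only by the SIGN of the cone.
PROOF: the dictionary ★ `exists_isConeHol_extension_of_probeCR` for `(−J, 𝔣♭)` applied to `φ♭ := conj ∘ Φ|_U` — law by `flip_law_of_unitary`, probes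
`conj ∘ (z ↦ Φ (u · exp (X♭ (ρ⁻¹ z̄)))) ∘ (z ↦ ρ z̄)` (`ρ = −⟪v₀,v₀⟫∕⟪t₀,t₀⟫`), real-differentiable with `ℂ`-linear differential by ★
`probeCR_of_isConeHol` for `(J, 𝔣)` and the probe `z ↦ X♭ (ρ⁻¹ z̄)`.
[cite: Borel1997, §5.13–§5.14] [cite: BorelWallach2000, VII 2.10] [cite: BergeronMillsonMoeglin2016Balls, Part 2 §1.3] -/
theorem exists_isConeHol_flip (hJ : (J.map w₁.1.embedding).IsHermitian) (𝔣 : ConeFrame E J w₁) {Φ : Matrix (Fin 2) (Fin 2) ℂ → ℂ}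
    (hΦ : IsConeHol 𝔣 Φ) :
    ∃ Φ' : Matrix (Fin 2) (Fin 2) ℂ → ℂ,
      IsConeHol (⟨𝔣.t₀, 𝔣.v₀, flip_v₀_mem 𝔣, flip_t₀_pos 𝔣, flip_orth hJ 𝔣⟩ : ConeFrame E (-J) w₁) Φ' ∧
        ∀ u : archLocal E 2 (-J) w₁,
          Φ' ((u : GL (Fin 2) ℂ) : Matrix (Fin 2) (Fin 2) ℂ) = starRingEnd ℂ (Φ ((u : GL (Fin 2) ℂ) : Matrix (Fin 2) (Fin 2) ℂ)) := by
  set 𝔣' : ConeFrame E (-J) w₁ := ⟨𝔣.t₀, 𝔣.v₀, flip_v₀_mem 𝔣, flip_t₀_pos 𝔣, flip_orth hJ 𝔣⟩ with h𝔣'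
  have hJ' : ((-J).map w₁.1.embedding).IsHermitian := isHermitian_neg hJ
  set M := J.map w₁.1.embedding with hM
  -- the probe of the flipped frame and its one-parameter family in `U(−M)`
  obtain ⟨X', hX'u, hX'v, hX't⟩ := exists_coneProbe 𝔣' hJ'
  obtain ⟨γ', hγ'⟩ := exists_expFamily_archLocal 𝔣' hJ' X' hX'u
  -- closed form of the antilinear half: `X' z v₀ = (ρ z̄) t₀`, `ρ = −⟪v₀,v₀⟫_{−M}∕⟪t₀,t₀⟫_{−M}`… read back on `M`: `ρ = −⟪v₀,v₀⟫∕⟪t₀,t₀⟫`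
  set ρ : ℂ := -((star 𝔣'.t₀ ⬝ᵥ ((-J).map w₁.1.embedding *ᵥ 𝔣'.t₀)) / (star 𝔣'.v₀ ⬝ᵥ ((-J).map w₁.1.embedding *ᵥ 𝔣'.v₀))) with hρ
  have hX'v₀ : ∀ z, X' z *ᵥ 𝔣.v₀ = (ρ * starRingEnd ℂ z) • 𝔣.t₀ := fun z => probe_mulVec_t₀ hJ' 𝔣' X' hX'u hX'v hX't z
  have hρreal : starRingEnd ℂ ρ = ρ := by
    have h1 : starRingEnd ℂ (star 𝔣'.t₀ ⬝ᵥ ((-J).map w₁.1.embedding *ᵥ 𝔣'.t₀)) = star 𝔣'.t₀ ⬝ᵥ ((-J).map w₁.1.embedding *ᵥ 𝔣'.t₀) :=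
      star_dotProduct_mulVec_self hJ' _
    have h2 : starRingEnd ℂ (star 𝔣'.v₀ ⬝ᵥ ((-J).map w₁.1.embedding *ᵥ 𝔣'.v₀)) = star 𝔣'.v₀ ⬝ᵥ ((-J).map w₁.1.embedding *ᵥ 𝔣'.v₀) :=
      star_dotProduct_mulVec_self hJ' _
    rw [hρ, map_neg, map_div₀, h1, h2]
  have hρ0 : ρ ≠ 0 := by
    rw [hρ, neg_ne_zero]
    exact div_ne_zero (form_t₀_ne_zero 𝔣') (form_v₀_ne_zero 𝔣')
  -- the `𝔣`-normalised probe `X'' z := X' (ρ⁻¹ z̄)` and the reparametrisation `B z := ρ z̄`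
  let A : ℂ →ₗ[ℝ] ℂ := ρ⁻¹ • Complex.conjAe.toLinearMap
  let X'' : ℂ →ₗ[ℝ] Matrix (Fin 2) (Fin 2) ℂ := X'.comp A
  have hA : ∀ z, A z = ρ⁻¹ * starRingEnd ℂ z := fun z => rfl
  have hX''v : ∀ z, X'' z *ᵥ 𝔣.v₀ = z • 𝔣.t₀ := by
    intro z
    show X' (A z) *ᵥ 𝔣.v₀ = z • 𝔣.t₀
    rw [hX'v₀, hA, map_mul, map_inv₀, hρreal, Complex.conj_conj, ← mul_assoc, mul_inv_cancel₀ hρ0, one_mul]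
  have hX''t : ∀ z, ∃ c : ℂ, X'' z *ᵥ 𝔣.t₀ = c • 𝔣.v₀ := fun z => ⟨A z, hX'v (A z)⟩
  let B : ℂ →L[ℝ] ℂ := ρ • (Complex.conjCLE : ℂ →L[ℝ] ℂ)
  have hB : ∀ z, B z = ρ * starRingEnd ℂ z := fun z => rfl
  have hAB : ∀ z, A (B z) = z := by
    intro z; rw [hB, hA, map_mul, hρreal, Complex.conj_conj, ← mul_assoc, inv_mul_cancel₀ hρ0, one_mul]
  -- the conjugate slice and its law
  let φ' : archLocal E 2 (-J) w₁ → ℂ := fun u => starRingEnd ℂ (Φ ((u : GL (Fin 2) ℂ) : Matrix (Fin 2) (Fin 2) ℂ))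
  have hφ'law : ∀ (u κ : archLocal E 2 (-J) w₁) (a k d : ℂ), k ≠ 0 →
      ((κ : GL (Fin 2) ℂ) : Matrix (Fin 2) (Fin 2) ℂ) *ᵥ 𝔣'.v₀ = k • 𝔣'.v₀ →
      ((κ : GL (Fin 2) ℂ) : Matrix (Fin 2) (Fin 2) ℂ) *ᵥ 𝔣'.t₀ = a • 𝔣'.t₀ + d • 𝔣'.v₀ → φ' (u * κ) = a * k⁻¹ * φ' u :=
    fun u κ a k d _ hκt hκv => flip_law_of_unitary hJ 𝔣 hΦ u κ a k d hκt hκv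
  -- the probes: `φ' (u · γ' z) = conj (P (B z))` with `P` the `𝔣`-probe of `Φ` at `u` along `X''`
  have key : ∀ u : archLocal E 2 (-J) w₁,
      DifferentiableAt ℝ (fun z : ℂ => φ' (u * γ' z)) 0 ∧
        ∀ z : ℂ, fderiv ℝ (fun z : ℂ => φ' (u * γ' z)) 0 (Complex.I • z) = Complex.I • fderiv ℝ (fun z : ℂ => φ' (u * γ' z)) 0 z := by
    intro u
    let u₀ : archLocal E 2 J w₁ := ⟨u.1, archLocal_neg (J := J) ▸ u.2⟩
    set P : ℂ → ℂ := fun z => Φ (((u₀ : GL (Fin 2) ℂ) : Matrix (Fin 2) (Fin 2) ℂ) * NormedSpace.exp (X'' z)) with hP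
    obtain ⟨hPd, hPCR⟩ := probeCR_of_isConeHol 𝔣 X'' hX''v hX''t hΦ u₀
    have hfun : (fun z : ℂ => φ' (u * γ' z)) = fun z => Complex.conjCLE (P (B z)) := by
      funext z
      show starRingEnd ℂ (Φ (((u * γ' z : archLocal E 2 (-J) w₁) : GL (Fin 2) ℂ) : Matrix (Fin 2) (Fin 2) ℂ)) =
        starRingEnd ℂ (Φ (((u₀ : GL (Fin 2) ℂ) : Matrix (Fin 2) (Fin 2) ℂ) * NormedSpace.exp (X'' (B z))))
      rw [Subgroup.coe_mul, Units.val_mul, hγ']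
      show starRingEnd ℂ (Φ (((u : GL (Fin 2) ℂ) : Matrix (Fin 2) (Fin 2) ℂ) * NormedSpace.exp (X' z))) =
        starRingEnd ℂ (Φ (((u : GL (Fin 2) ℂ) : Matrix (Fin 2) (Fin 2) ℂ) * NormedSpace.exp (X' (A (B z)))))
      rw [hAB]
    have hB0 : B 0 = 0 := map_zero B
    have hcomp : HasFDerivAt (fun z : ℂ => Complex.conjCLE (P (B z)))
        ((Complex.conjCLE : ℂ →L[ℝ] ℂ).comp ((fderiv ℝ P 0).comp B)) 0 := by
      have hPB : HasFDerivAt (fun z => P (B z)) ((fderiv ℝ P 0).comp B) 0 := by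
        have hP0 : HasFDerivAt P (fderiv ℝ P 0) (B 0) := by rw [hB0]; exact hPd.hasFDerivAt
        exact hP0.comp 0 B.hasFDerivAt
      exact (Complex.conjCLE : ℂ →L[ℝ] ℂ).hasFDerivAt.comp 0 hPB
    rw [hfun]
    refine ⟨hcomp.differentiableAt, fun z => ?_⟩
    have hBI : B (Complex.I • z) = -(Complex.I • B z) := by
      rw [hB, hB, smul_eq_mul, smul_eq_mul, map_mul, Complex.conj_I]; ring
    rw [hcomp.fderiv, ContinuousLinearMap.comp_apply, ContinuousLinearMap.comp_apply, ContinuousLinearMap.comp_apply,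
      ContinuousLinearMap.comp_apply, hBI, map_neg, hPCR (B z), map_neg, ContinuousLinearEquiv.coe_coe, Complex.conjCLE_apply,
      Complex.conjCLE_apply, smul_eq_mul, smul_eq_mul, map_mul, Complex.conj_I]
    ring
  obtain ⟨Φ', hΦ', hres⟩ := exists_isConeHol_extension_of_probeCR 𝔣' hJ' X' hX'u hX'v hX't γ' hγ' φ' hφ'law
    (fun u => (key u).1) (fun u z => (key u).2 z)
  exact ⟨Φ', hΦ', hres⟩

end Summit.HodgeConjecture.HodgeConjecture.Cruxes.HLiu418.F0LD2ConeFlip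

end
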